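import Mathlib
import Summits.PneNP.PneNP.Theorems.ConvexRankGatesConvexGateBlindAffineUnique

/-!
# PneNP / ConvexRankGates — `ConvexGateBlind`: AFFINE column objects need exactly `C(m,k)` terms

Helpers (`--supports stmt-PneNP-10680`), COLUMN-SPACE line (prover seat 2, session 24): the restricted class on the OTHER
side of the LP slice of the crux.

Sessions 13–23 restricted the ROW objects `V_l` (functions of the `k`-set `Q`) to the column space
`W = span{Q ↦ [e ⊆ Q]}` (= affine functions of the clique input) and proved that such factorisations of `cdist Q u − ε`
need `exp(Ω(m^{1/2−δ}))` terms. Here the COLUMN objects `U_l` (functions of the `k`-clique-free graph `u`) are restricted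
instead: `U_l(u) = a_l − t_l(u)` AFFINE in the edge-indicator vector of `u` and `≥ 0` on clique-free graphs, i.e.
`t_l·x ≤ a_l` is a valid inequality of the `k`-clique-free polytope (gate language: lift-free LP refutations; matrix
language: the restricted non-negative rank of the TRANSPOSED shifted clique-distance matrix; polyhedral language: polyhedra
`{x : t_i·x ≤ a_i, i < R}` sandwiched between the `k`-clique-free polytope and `{x : x(E(Q)) ≤ C(k,2) − ε ∀Q}`). On this
side the answer is exact and non-asymptotic:

* `affine_terms_lower_bound` — **every factorisation `cdist Q u − ε = ∑_{l<R} U_l(u) V_l(Q)` (`ε > 0`, `V_l ≥ 0` on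
  `k`-sets, `3 ≤ k`) with affine column objects non-negative on `k`-clique-free graphs has `R ≥ C(m,k)` terms**, for every
  `m`: the identity is affine in `1_u`; at `u = ∅` and `u = {f}` it gives `∑_l a_l V_l(Q) = #E(Q) − ε` and
  `∑_l t_l(f) V_l(Q) = [f ⊆ Q]`, hence `∑_l (a_l − t_l(E(Q))) V_l(Q) = −ε < 0` — some valid `(t_l, a_l)` with `V_l(Q) > 0`
  CATCHES the bare clique `Q`, and by `caught_clique_unique` the map `Q ↦ l` is injective.
* `affine_factorisation_of_le_one` — sharpness: for every `ε ≤ 1`, `C(m,k)` affine terms suffice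
  (`U_Q(u) = cdist Q u − ε ≥ 1 − ε`, `one_le_cdist`; `V_Q = δ_Q`).
So the affine-restricted non-negative rank of the shifted clique-distance matrix is `≤ C(m,2)` at `ε = 0` and EXACTLY
`C(m,k)` for every `0 < ε ≤ 1`. With the column-space theorem, BOTH one-sided restricted classes of the LP slice are settled:
a polynomial-size LP refutation of the crux must lift on both sides. [new]
-/

set_option linter.dupNamespace false

namespace Summit.PneNP.PneNP.Theorems

open Finset Real Filter Literature.Computability.Complexity
open Summit.PneNP.PneNP.Cruxes.ConvexGateBlind.StrictRankConicCover (Edge cdist)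

noncomputable section

variable {m : ℕ}

/-! ## Affine column objects: `C(m,k)` terms are necessary … -/

/-- `cdist Q ∅ = #E(Q)`. [folklore] -/
theorem cdist_empty (Q : Finset (Fin m)) : cdist Q (fun _ => false) = ((cliqueEdges Q).card : ℝ) := by
  classical
  unfold cdist
  rw [cliqueEdges, ← Finset.sum_boole]
  exact Finset.sum_congr rfl fun e _ => by simp

/-- **Affine column objects need `C(m,k)` terms.** Let `3 ≤ k`, `ε > 0`, and
`cdist Q u − ε = ∑_{l<R} U_l(u) V_l(Q)` for all `k`-sets `Q` and all `k`-clique-free `u`, with `V_l ≥ 0` on `k`-sets and every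
column object AFFINE in the graph and non-negative on clique-free graphs: `U_l(u) = a_l − t_l(u) ≥ 0`. Then `C(m,k) ≤ R`.
PROOF: the identity is affine in `1_u` for fixed `Q`; at `u = ∅` it reads `#E(Q) − ε = ∑ a_l V_l(Q)`, at `u = {f}` it gives
`[f ⊆ Q] = ∑_l t_l(f) V_l(Q)`; summing over `f ∈ E(Q)`: `∑_l (a_l − t_l(E(Q))) V_l(Q) = −ε < 0`, so some `l` has `V_l(Q) > 0`
and `t_l(E(Q)) > a_l ≥ t_l(u)` for all clique-free `u` — the valid inequality `(t_l, a_l)` CATCHES `Q`. By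
`caught_clique_unique`, `Q ↦ l` is injective on `k`-sets. [new] -/
theorem affine_terms_lower_bound {k R : ℕ} (hk : 3 ≤ k)
    (U : (Edge m → Bool) → Fin R → ℝ) (V : Fin R → Finset (Fin m) → ℝ)
    (hU : ∀ u l, cliqueFn m k u = false → 0 ≤ U u l)
    (hV : ∀ l (Q : Finset (Fin m)), Q.card = k → 0 ≤ V l Q)
    (haff : ∀ l, ∃ (a : ℝ) (t : Edge m → ℝ), ∀ u, cliqueFn m k u = false →
      U u l = a - ∑ f, (if u f = true then t f else 0))
    (ε : ℝ) (hε : 0 < ε)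
    (hfact : ∀ (Q : Finset (Fin m)) (u : Edge m → Bool), Q.card = k → cliqueFn m k u = false →
      cdist Q u - ε = ∑ l, U u l * V l Q) :
    m.choose k ≤ R := by
  classical
  choose a t hat using haff
  -- validity of `(t_l, a_l)`
  have hvalid : ∀ l (u : Edge m → Bool), cliqueFn m k u = false → (∑ f, if u f = true then t l f else 0) ≤ a l := by
    intro l u hu
    have h := hU u l hu
    rw [hat l u hu] at h
    linarith
  have hU0 : ∀ l, U (fun _ => false) l = a l := by
    intro l
    rw [hat l _ (cliqueFn_empty_eq_false hk)]
    simp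
  -- every `k`-set is caught by a term with positive row value
  have hcatch : ∀ Q : Finset (Fin m), Q.card = k → ∃ l, 0 < V l Q ∧ a l < ∑ f ∈ cliqueEdges Q, t l f := by
    intro Q hQ
    have h0 := hfact Q (fun _ => false) hQ (cliqueFn_empty_eq_false hk)
    have h1 : ∀ f : Edge m, (if cliqueVec Q f = true then (1 : ℝ) else 0) = ∑ l, t l f * V l Q := by
      intro f
      have hf := hfact Q (fun g => decide (g = f)) hQ (cliqueFn_single_eq_false hk f)
      rw [← cdist_empty_sub_cdist_single Q f]
      have hUf : ∀ l, U (fun g => decide (g = f)) l = a l - t l f := by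
        intro l
        rw [hat l _ (cliqueFn_single_eq_false hk f)]
        congr 1
        rw [Finset.sum_eq_single f]
        · simp
        · intro g _ hgf; simp [hgf]
        · intro h; exact absurd (Finset.mem_univ f) h
      have hdiff : cdist Q (fun _ => false) - cdist Q (fun g => decide (g = f)) =
          ∑ l, U (fun _ => false) l * V l Q - ∑ l, U (fun g => decide (g = f)) l * V l Q := by linarith
      rw [hdiff, ← Finset.sum_sub_distrib]
      exact Finset.sum_congr rfl fun l _ => by rw [hUf, hU0]; ring
    -- sum the single-edge identities over `E(Q)`
    have hsumE : ((cliqueEdges Q).card : ℝ) = ∑ l, (∑ f ∈ cliqueEdges Q, t l f) * V l Q := by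
      have : ((cliqueEdges Q).card : ℝ) = ∑ f ∈ cliqueEdges Q, (if cliqueVec Q f = true then (1 : ℝ) else 0) := by
        rw [Finset.card_eq_sum_ones (cliqueEdges Q)]
        push_cast
        refine Finset.sum_congr rfl fun f hf => ?_
        rw [cliqueEdges, Finset.mem_filter] at hf
        simp [hf.2]
      rw [this, Finset.sum_congr rfl fun f _ => h1 f, Finset.sum_comm]
      exact Finset.sum_congr rfl fun l _ => by rw [Finset.sum_mul]
    rw [cdist_empty, Finset.sum_congr rfl fun l _ => by rw [hU0 l]] at h0
    -- `∑_l (a_l − t_l(E(Q))) V_l(Q) = −ε < 0`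
    have hneg : ∑ l, (a l - ∑ f ∈ cliqueEdges Q, t l f) * V l Q < ∑ _l : Fin R, (0 : ℝ) := by
      rw [Finset.sum_const_zero]
      have : ∑ l, (a l - ∑ f ∈ cliqueEdges Q, t l f) * V l Q =
          ∑ l, a l * V l Q - ∑ l, (∑ f ∈ cliqueEdges Q, t l f) * V l Q := by
        rw [← Finset.sum_sub_distrib]
        exact Finset.sum_congr rfl fun l _ => by ring
      rw [this, ← hsumE, ← h0]
      linarith
    obtain ⟨l, -, hl⟩ := Finset.exists_lt_of_sum_lt hneg
    have hVpos : 0 < V l Q := by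
      rcases (hV l Q hQ).lt_or_eq with h | h
      · exact h
      · rw [← h, mul_zero] at hl; exact absurd hl (lt_irrefl 0)
    refine ⟨l, hVpos, ?_⟩
    have := neg_of_mul_neg_left hl hVpos.le
    linarith
  -- the injection `Q ↦ l(Q)`
  choose φ hφ using hcatch
  set S := (Finset.univ : Finset (Fin m)).powersetCard k with hS
  have hmemS : ∀ Q : S, (Q : Finset (Fin m)).card = k := fun Q => (Finset.mem_powersetCard.1 Q.2).2
  set ψ : S → Fin R := fun Q => φ Q.1 (hmemS Q) with hψ
  have hinj : Function.Injective ψ := by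
    intro Q₁ Q₂ h
    apply Subtype.ext
    have h1 := hφ Q₁.1 (hmemS Q₁)
    have h2 := hφ Q₂.1 (hmemS Q₂)
    rw [show φ Q₂.1 (hmemS Q₂) = ψ Q₂ from rfl, ← h] at h2
    exact caught_clique_unique hk (t (ψ Q₁)) (a (ψ Q₁)) (hvalid (ψ Q₁)) (hmemS Q₁) (hmemS Q₂) h1.2 h2.2
  have hcard := Fintype.card_le_of_injective ψ hinj
  rw [Fintype.card_coe, hS, Finset.card_powersetCard, Finset.card_univ, Fintype.card_fin, Fintype.card_fin] at hcard
  exact hcard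

/-! ## … and sufficient (for `ε ≤ 1`) -/

/-- A `k`-clique-free graph misses an edge of every `k`-set: `1 ≤ cdist Q u`. [folklore] -/
theorem one_le_cdist {k : ℕ} {Q : Finset (Fin m)} (hQ : Q.card = k) {u : Edge m → Bool}
    (hu : cliqueFn m k u = false) : 1 ≤ cdist Q u := by
  classical
  -- some edge of `Q` is off in `u`
  have hex : ∃ e : Edge m, cliqueVec Q e = true ∧ u e = false := by
    by_contra hcon
    have hle : cliqueVec Q ≤ u := fun e => Bool.le_iff_imp.2 fun h => by
      by_contra h'
      exact hcon ⟨e, h, Bool.eq_false_iff.2 h'⟩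
    have hmono := cliqueFn_monotone_holds m k hle
    rw [cliqueFn_cliqueVec (s := k) (S := Q) (by rw [hQ]), hu] at hmono
    exact absurd hmono (by decide)
  obtain ⟨e, he⟩ := hex
  unfold cdist
  calc (1 : ℝ) = (if cliqueVec Q e = true ∧ u e = false then (1 : ℝ) else 0) := by rw [if_pos he]
    _ ≤ ∑ f, (if cliqueVec Q f = true ∧ u f = false then (1 : ℝ) else 0) :=
        Finset.single_le_sum (f := fun f => if cliqueVec Q f = true ∧ u f = false then (1 : ℝ) else 0)
          (fun f _ => by positivity) (Finset.mem_univ e)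

/-- `cdist Q u = #E(Q) − #(E(Q) ∩ u)`: the clique-distance column of `Q` is affine in the graph. [folklore] -/
theorem cdist_eq_card_sub_sum (Q : Finset (Fin m)) (u : Edge m → Bool) :
    cdist Q u = ((cliqueEdges Q).card : ℝ) -
      ∑ f, (if u f = true then (if cliqueVec Q f = true then (1 : ℝ) else 0) else 0) := by
  classical
  rw [← cdist_empty]
  unfold cdist
  rw [← Finset.sum_sub_distrib]
  refine Finset.sum_congr rfl fun f _ => ?_
  cases cliqueVec Q f <;> cases u f <;> simp

/-- **Sharpness: `C(m,k)` affine terms suffice for `ε ≤ 1`.** `cdist Q u − ε = ∑_{Q'} (cdist Q' u − ε)·[Q' = Q]`, and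
`U_{Q'}(u) = cdist Q' u − ε = (#E(Q') − ε) − #(E(Q') ∩ u)` is affine in `u` and `≥ 1 − ε ≥ 0` on `k`-clique-free graphs
(`one_le_cdist`). With `affine_terms_lower_bound`: the affine-restricted non-negative rank of the shifted clique-distance
matrix is EXACTLY `C(m,k)` for every `0 < ε ≤ 1` (and `≤ C(m,2)` at `ε = 0`). [new] -/
theorem affine_factorisation_of_le_one (k : ℕ) (ε : ℝ) (hε : ε ≤ 1) :
    ∃ (U : (Edge m → Bool) → Fin (m.choose k) → ℝ) (V : Fin (m.choose k) → Finset (Fin m) → ℝ),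
      (∀ u l, cliqueFn m k u = false → 0 ≤ U u l) ∧ (∀ l Q, 0 ≤ V l Q) ∧
      (∀ l, ∃ (a : ℝ) (t : Edge m → ℝ), ∀ u, U u l = a - ∑ f, (if u f = true then t f else 0)) ∧
      ∀ (Q : Finset (Fin m)) (u : Edge m → Bool), Q.card = k → cliqueFn m k u = false →
        cdist Q u - ε = ∑ l, U u l * V l Q := by
  classical
  set S := (Finset.univ : Finset (Fin m)).powersetCard k with hS
  have hcardS : Fintype.card S = m.choose k := by
    rw [Fintype.card_coe, hS, Finset.card_powersetCard, Finset.card_univ, Fintype.card_fin]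
  set eqv : S ≃ Fin (m.choose k) := Fintype.equivFinOfCardEq hcardS with heqv
  have hmemS : ∀ Q : S, (Q : Finset (Fin m)).card = k := fun Q => (Finset.mem_powersetCard.1 Q.2).2
  refine ⟨fun u l => cdist (eqv.symm l).1 u - ε, fun l Q => if Q = (eqv.symm l).1 then 1 else 0,
    fun u l hu => ?_, fun l Q => by positivity, fun l => ?_, fun Q u hQ hu => ?_⟩
  · have := one_le_cdist (hmemS (eqv.symm l)) hu
    dsimp only
    linarith
  · refine ⟨((cliqueEdges (eqv.symm l).1).card : ℝ) - ε,
      fun f => if cliqueVec (eqv.symm l).1 f = true then (1 : ℝ) else 0, fun u => ?_⟩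
    dsimp only
    rw [cdist_eq_card_sub_sum]
    ring
  · have hQS : Q ∈ S := by
      rw [hS, Finset.mem_powersetCard]; exact ⟨Finset.subset_univ _, hQ⟩
    rw [Finset.sum_eq_single (eqv ⟨Q, hQS⟩)]
    · simp
    · intro l _ hl
      have hne : Q ≠ (eqv.symm l).1 := by
        intro h
        apply hl
        have h' : eqv.symm l = ⟨Q, hQS⟩ := Subtype.ext h.symm
        rw [← h', Equiv.apply_symm_apply]
      simp [hne]
    · intro h; exact absurd (Finset.mem_univ _) h

/-! ## Registered forms -/

/-- **Affine column objects need `C(m,k)` terms** (registered form of `affine_terms_lower_bound`). [new] -/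
theorem affine_column_terms_ge_choose : ∀ {m k R : ℕ}, 3 ≤ k → ∀ (U : (Edge m → Bool) → Fin R → ℝ) (V : Fin R → Finset (Fin m) → ℝ), (∀ u l, cliqueFn m k u = false → 0 ≤ U u l) → (∀ l (Q : Finset (Fin m)), Q.card = k → 0 ≤ V l Q) → (∀ l, ∃ (a : ℝ) (t : Edge m → ℝ), ∀ u, cliqueFn m k u = false → U u l = a - ∑ f, (if u f = true then t f else 0)) → ∀ (ε : ℝ), 0 < ε → (∀ (Q : Finset (Fin m)) (u : Edge m → Bool), Q.card = k → cliqueFn m k u = false → cdist Q u - ε = ∑ l, U u l * V l Q) → m.choose k ≤ R :=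
  fun hk U V hU hV haff ε hε hfact => affine_terms_lower_bound hk U V hU hV haff ε hε hfact

/-- **`C(m,k)` affine terms suffice for `ε ≤ 1`** (registered form of `affine_factorisation_of_le_one`). [new] -/
theorem affine_column_terms_le_choose : ∀ (m k : ℕ) (ε : ℝ), ε ≤ 1 → ∃ (U : (Edge m → Bool) → Fin (m.choose k) → ℝ) (V : Fin (m.choose k) → Finset (Fin m) → ℝ), (∀ u l, cliqueFn m k u = false → 0 ≤ U u l) ∧ (∀ l Q, 0 ≤ V l Q) ∧ (∀ l, ∃ (a : ℝ) (t : Edge m → ℝ), ∀ u, U u l = a - ∑ f, (if u f = true then t f else 0)) ∧ ∀ (Q : Finset (Fin m)) (u : Edge m → Bool), Q.card = k → cliqueFn m k u = false → cdist Q u - ε = ∑ l, U u l * V l Q :=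
  fun _ k ε hε => affine_factorisation_of_le_one k ε hε

end

end Summit.PneNP.PneNP.Theorems
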